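import Literature.IUT.LogVolume.DistinguishedPrimesBound
import HarnessLib

/-!
# [IUTchIV] Theorem 1.10, Step (iii), for REAL towers of number fields, II: the printed (D6) when
# `F_tpd/F_mod` is Galois

Mochizuki, *Inter-universal Teichmüller theory IV*, RIMS manuscript (Apr. 2020; = PRIMS **57** (2021)),
Theorem 1.10, proof Step (iii), pp. 24–26 (kurims `paper:url-56bcb0f95768`): the distinguished primes are
those `v_ℚ` with (D6) "Either `p_{v_ℚ} | 2·3·5·l` or `v_ℚ` lies in the image of `Supp(𝔮^{F_tpd}_ADiv +
𝔡^{F_tpd}_ADiv)`", and "`log(𝔰^ℚ) ≤ 2·d_mod·(log(𝔡^{F_tpd}) + log(𝔣^{F_tpd})) + log(2·3·5·l)`" (p. 26).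

Sequel of `DistinguishedPrimesBound.lean`, whose `sum_log_distinguished_le` proves this bound for actual
number fields `F ⊆ K` (read `F_mod ⊆ F_tpd`) under the hypothesis that each distinguished prime not dividing
`2·3·5·l` lies under a place `v` of `F` which is bad or above which EVERY place of `K` is ramified over `ℚ`.
Here that hypothesis is derived from the printed (D6) when `K/F` is Galois (as `F_tpd = F_mod(E_{F_mod}[2])`
is over `F_mod`): the absolute ramification index is constant along the fibres of a Galois extension
(`ramificationIdx_int_eq_of_finBelow_eq`: `e(w|p) = e(v|p)·e(w|v)`, Mathlib `ramificationIdx_tower` +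
`ramificationIdx_eq_of_isGaloisGroup`), and a place in the support of the different divisor is ramified over
`ℚ` (`two_le_ramificationIdx_int_of_multiplicity_pos`, from `multiplicity_absDifferent_eq_zero_of_ramificationIdx_eq_one`
= "unramified ⇒ `w ∤ 𝔡_{K/ℚ}`", the `e = 1` case of Neukirch III (2.6) over the base `ℤ` via the tree's
trace-form lemma `not_pow_dvd_differentIdeal_of_natCast_ramificationIdx_notMem`). Result:

* `sum_log_distinguished_le_of_isGalois` — **Step (iii) for actual fields with (D6) as printed**: `K/F`
  Galois, every `q ∈ dst` divides `2·3·5·l` or lies under a place `v` of `F` with `v` bad or some `w₀ | v`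
  in `Supp(𝔡^K_ADiv)` ⟹ `Σ_{q∈dst} log q ≤ 2·[F:ℚ]·(deg(𝔡^K_ADiv) + deg(𝔣^K_ADiv)) + log(2·3·5·l)` — the
  field `sQ_le` of `Thm110Numerics.ProofData` for real number fields.

Classical algebraic number theory; nothing here takes a side on [IUTchIII] Cor. 3.12.
-/

noncomputable section

namespace Literature.IUT.LogVolume

open NumberField IsDedekindDomain Finset
open Literature.NumberTheory.NumberFields (not_pow_dvd_differentIdeal_of_natCast_ramificationIdx_notMem
  natCast_mem_iff_absNorm_under_dvd)
open scoped Classical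

variable (F K : Type*) [Field F] [NumberField F] [Field K] [NumberField K] [Algebra F K]

section Absolute

variable {K}

/-- **Unramified over `ℚ` ⇒ `ord_w 𝔡_{K/ℚ} = 0`**: if `e(w | p_w) = 1` then `w ∤ 𝔡_{K/ℚ}` (the case `e = 1`
of Neukirch III (2.6) / Serre III §6 Prop. 13 over the base `ℤ`, from the tree's
`not_pow_dvd_differentIdeal_of_natCast_ramificationIdx_notMem`). [cite: NeukirchANT1999, Ch. III (2.6)] -/
theorem multiplicity_absDifferent_eq_zero_of_ramificationIdx_eq_one (w : HeightOneSpectrum (𝓞 K))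
    (h : w.asIdeal.ramificationIdx ℤ = 1) : multiplicity w.asIdeal (differentIdeal ℤ (𝓞 K)) = 0 := by
  classical
  haveI : w.asIdeal.IsMaximal := w.isMaximal
  set p : ℕ := residueChar K w with hpdef
  have hp : p.Prime := residueChar_prime K w
  haveI hpI : (Ideal.span {(p : ℤ)}).IsMaximal :=
    Ideal.IsPrime.isMaximal (Ideal.span_singleton_prime (by exact_mod_cast hp.ne_zero) |>.mpr
      (Nat.prime_iff_prime_int.mp hp)) (by simp [hp.ne_zero])
  have hpb : (Ideal.span {(p : ℤ)}) ≠ ⊥ := by simp [hp.ne_zero]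
  haveI : w.asIdeal.LiesOver (Ideal.span {(p : ℤ)}) := liesOver_residueChar K w
  have hp' : (Ideal.span {(p : ℤ)}).map (algebraMap ℤ (𝓞 K)) ≠ ⊥ := Ideal.map_ne_bot_of_ne_bot hpb
  -- factorisation `p 𝓞_K = w^1 * I`, `w + I = 𝓞_K`
  obtain ⟨I, hcop, hfac⟩ := Ideal.eq_prime_pow_mul_coprime hp' w.asIdeal
  rw [← Ideal.IsDedekindDomain.ramificationIdx_eq_normalizedFactors_count (Ideal.span {(p : ℤ)}) w.asIdeal hp', h]
    at hfac
  haveI : (w.asIdeal ^ 1).LiesOver (Ideal.span {(p : ℤ)}) := by rw [pow_one]; infer_instance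
  letI := Ideal.Quotient.field (Ideal.span {(p : ℤ)})
  letI := Ideal.Quotient.field w.asIdeal
  haveI : Finite (ℤ ⧸ Ideal.span {(p : ℤ)}) := Ideal.finiteQuotientOfFreeOfNeBot _ hpb
  haveI : Algebra.IsAlgebraic (ℤ ⧸ Ideal.span {(p : ℤ)}) (𝓞 K ⧸ w.asIdeal) := Algebra.IsAlgebraic.of_finite _ _
  have key := not_pow_dvd_differentIdeal_of_natCast_ramificationIdx_notMem ℤ ℚ K (𝓞 K) hpb w.asIdeal
    hfac hcop (e := 1) (by
      rw [Ideal.mem_span_singleton]; norm_cast; exact hp.one_lt.ne' ∘ Nat.dvd_one.mp)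
  rw [pow_one] at key
  exact multiplicity_eq_zero.mpr key

/-- **`ord_w 𝔡_{K/ℚ} > 0 ⇒ e(w | p_w) ≥ 2`** ("a prime is ramified iff it divides the different").
[cite: NeukirchANT1999, Ch. III (2.6)] -/
theorem two_le_ramificationIdx_int_of_multiplicity_pos (w : HeightOneSpectrum (𝓞 K))
    (h : 0 < multiplicity w.asIdeal (differentIdeal ℤ (𝓞 K))) : 2 ≤ w.asIdeal.ramificationIdx ℤ := by
  haveI : w.asIdeal.IsMaximal := w.isMaximal
  have h1 : 1 ≤ w.asIdeal.ramificationIdx ℤ := Ideal.ramificationIdx_pos w.asIdeal ℤ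
  by_contra hlt
  have he : w.asIdeal.ramificationIdx ℤ = 1 := by omega
  have := multiplicity_absDifferent_eq_zero_of_ramificationIdx_eq_one (K := K) w he
  omega

end Absolute

section Galois

variable {F K}

/-- In a GALOIS extension `K/F`, the absolute ramification index `e(w | p)` is constant along the fibre of a
place `v` of `F` (`e(w|p) = e(v|p)·e(w|v)` and `e(w|v)` does not depend on `w | v`: conjugate places ramify
together). [cite: NeukirchANT1999, Ch. I (9.3)] -/
theorem ramificationIdx_int_eq_of_finBelow_eq [IsGalois F K] (w w' : HeightOneSpectrum (𝓞 K))
    (h : finBelow F K w = finBelow F K w') :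
    w.asIdeal.ramificationIdx ℤ = w'.asIdeal.ramificationIdx ℤ := by
  haveI : w.asIdeal.IsMaximal := w.isMaximal
  haveI : w'.asIdeal.IsMaximal := w'.isMaximal
  let G := K ≃ₐ[F] K
  haveI : IsGaloisGroup G (𝓞 F) (𝓞 K) := IsGaloisGroup.of_isFractionRing G (𝓞 F) (𝓞 K) F K
  haveI : w'.asIdeal.LiesOver (finBelow F K w).asIdeal := by rw [h]; infer_instance
  have hrel : w.asIdeal.ramificationIdx (𝓞 F) = w'.asIdeal.ramificationIdx (𝓞 F) :=
    Ideal.ramificationIdx_eq_of_isGaloisGroup (finBelow F K w).asIdeal w.asIdeal w'.asIdeal G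
  have hu : w.asIdeal.under (𝓞 F) = w'.asIdeal.under (𝓞 F) := congrArg HeightOneSpectrum.asIdeal h
  rw [Ideal.ramificationIdx_tower (R := ℤ) (w.asIdeal.under (𝓞 F)) w.asIdeal,
    Ideal.ramificationIdx_tower (R := ℤ) (w'.asIdeal.under (𝓞 F)) w'.asIdeal, hrel, hu]

variable (F K)

/-- **[IUTchIV] Thm. 1.10, Step (iii), for ACTUAL number fields, with the PRINTED (D6)**: for `K/F` GALOIS
(read `F_tpd/F_mod`), bad places `S` of `F`, `T` the places of `K` over `S`, `l ≥ 1`, and a finite set `dst`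
of primes such that every `q ∈ dst` either divides `2·3·5·l` or lies under a place `v` of `F` that is bad
(`v` under `Supp(𝔮^K_ADiv)`) or under the support of the different divisor `𝔡^K_ADiv` (some `w₀ | v` with
`ord_{w₀} 𝔡_{K/ℚ} > 0`) — (D6): "Either `p_{v_ℚ} | 2·3·5·l` or `v_ℚ` lies in the image of
`Supp(𝔮^{F_tpd}_ADiv + 𝔡^{F_tpd}_ADiv)`" read through a place of `F_mod` —:
`Σ_{q ∈ dst} log q ≤ 2·[F:ℚ]·(deg(𝔡^K_ADiv) + deg(𝔣^K_ADiv)) + log(2·3·5·l)` (p. 26). Galoisness of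
`F_tpd = F_mod(E_{F_mod}[2])` over `F_mod` makes ALL places over `v` ramified over `ℚ` as soon as one is
(`ramificationIdx_int_eq_of_finBelow_eq`), which is the input of `sum_log_distinguished_le`.
[claim: Mochizuki2012, status: disputed] -/
theorem sum_log_distinguished_le_of_isGalois [IsGalois F K] (S : Finset (HeightOneSpectrum (𝓞 F)))
    (T : Finset (HeightOneSpectrum (𝓞 K))) (hT : ∀ w, w ∈ T ↔ finBelow F K w ∈ S)
    {l : ℕ} (hl : 0 < l) (dst : Finset ℕ) (hdst : ∀ q ∈ dst, q.Prime)
    (D6 : ∀ q ∈ dst, q ∣ 2 * 3 * 5 * l ∨ ∃ v : HeightOneSpectrum (𝓞 F), residueChar F v = q ∧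
      (v ∈ S ∨ ∃ w₀ : HeightOneSpectrum (𝓞 K), finBelow F K w₀ = v ∧
        0 < multiplicity w₀.asIdeal (differentIdeal ℤ (𝓞 K)))) :
    ∑ q ∈ dst, Real.log q ≤
      2 * Module.finrank ℚ F * (ndeg K (differentDivisor K) + ndeg K (ADivisor.reduced T)) +
        Real.log (2 * 3 * 5 * (l : ℝ)) := by
  refine sum_log_distinguished_le F K S T hT hl dst hdst fun q hq => ?_
  rcases D6 q hq with h | ⟨v, hvq, hv⟩
  · exact Or.inl h
  · refine Or.inr ⟨v, hvq, ?_⟩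
    rcases hv with hbad | ⟨w₀, hw₀, hpos⟩
    · exact Or.inl hbad
    · refine Or.inr fun w hw => ?_
      rw [ramificationIdx_int_eq_of_finBelow_eq w w₀ (hw.trans hw₀.symm)]
      exact two_le_ramificationIdx_int_of_multiplicity_pos w₀ hpos

end Galois

end Literature.IUT.LogVolume

end
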